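import Literature.NumberTheory.Automorphic.SplitTorusOrderStratumParity   -- ★ T3′ O8a parity (A-p19): `exists_poly_eval_mul_eq_one`, ★ :243 odd half; brings ★ O8a-4∕O8a-1∕O8a-∃∕O7 and ★ `exists_norm_solution_of_zpow_even`
import HarnessLib

/-!
# Self-dual `τ`-cyclic lattices: the parity dichotomy `#{…} = [C : R^×]` UNIFORM IN THE RESIDUE CHARACTERISTIC — the trace-weighted Cayley symmetriser

Topic `NumberTheory/Automorphic`; namespace `Literature.NumberTheory.Automorphic`.  THEOREMS ONLY (no definition, no instance, no notation, no named fact, no `sorry`);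
kernel lane `--supports stmt-HodgeConjecture-24833`.  Cell `pub/hodgecm-mathlib`, LH4 price list (U1) (dealer LH4-plan (g7) WORD #19∕#34; consumers (C6)-2 LH3-p02 and
(C6)-3 LH7-p03; FINDING #15: ROW-2 parity RHS verbatim, no `ord 2` shift).  Seat LH5-p01 (g5).  HONEST LABEL: HC_CM is proved only modulo the printed citations (hLiu418 =
stmt-HodgeConjecture-24832, h413 = stmt-HodgeConjecture-24833) until rung 0 closes; (D-UNR) stays PRINT; this file is a count-neutral twin of ★ `SplitTorusOrderStratumParity`
:169 `ncard_setOf_selfDual_cyclic_eq_relIndex_of_even` with the binders `(h2 : IsUnit 2) (δ) (hδ) (hσδ)` DELETED and the trace token `(htr : ∃ b : 𝒪, b + σ b = 1)` of ★ :243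
ADDED; the set counted and the `relIndex` value are ★'s TOKEN FOR TOKEN.

WHERE ★ READ `|2| = 1` (census of ★ :134–:243): (i) ★ :136 «`1 + γ_i ∈ 𝒪^×` for a deep node» — FALSE at a dyadic place; (ii) ★ :188–:199 `htr` from `b := 2⁻¹`; (iii) the skew
unit `δ` as a BINDER feeding ★ O8a-∃'s CAYLEY SYMMETRISER `s_ij = (γ_i − γ_j)∕((1+γ_i)(1+γ_j)δ)`.  Everything else (★ O8a-4, O8a-1, `exists_norm_solution_of_zpow_even`, the
odd half ★ :243) is already uniform.

THE 2-FREE ROUTE (the TRACE-WEIGHTED CAYLEY symmetriser).  With `b + σb = 1` put **`u_i := b + σb·γ_i`**.  For a norm-one node (`σγ_i = γ_i⁻¹`): `σu_i = σb + b·γ_i⁻¹ =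
u_i·γ_i⁻¹` (so `γ_i = u_i∕σu_i`, a Hilbert-90 witness), and for a DEEP node `u_i = 1 + σb·(γ_i − 1)` is a `1`-UNIT at every residue characteristic — it replaces ★'s
`1 + γ_i = 2·((1+γ_i)∕2)`.  The quotient `x_ij := (γ_i − γ_j)∕(u_i u_j)` is SKEW (`σx_ij = −x_ij`, the same one-line computation as ★ `cayleyQuotient_skew`), and a skew unit
needs no binder: `δ := σa − a` from the «`σ` moves an integer by a unit» hypothesis `hmove` itself.  Hence ★ O8a-∃ §1–§2 go through VERBATIM with `1 + γ ↦ u`: `s_ij := x_ij∕δ`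
is σ-fixed, `f′(γ)_i = s_i·λ_i`, `λ_i = (u_iδ)^{n−1}·∏_{j≠i}u_j ∈ R = 𝒪[γ]` (`u = (C b + C σb·X)(γ)`, ★ O7 ring calculus) with UNIT components, and the norm equations
`a_iσ(a_i)·(d_i s_i) = 1` (`|d_i s_i| = |d_i f′(γ)_i| = |ϖ|^{2k_i}`) are solved by ★ `exists_norm_solution_of_zpow_even`.  With `b := ½`, `δ` the old skew unit, every
statement specialises to ★'s (the factors `2` cancel inside `s_ij`, `λ_i`).

* §1 `traceCayleyQuotient_skew`, `exists_mul_traceCayley_eq_one_of_deep`, `sub_eq_traceSymm_mul`, `traceSymm_fixed`, `nodalDeriv_eq_traceSymm_mul`, `traceSymmProd_fixed`,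
  `traceSymmFactor_eq`, `prod_erase_traceCayley_eq`, `traceSymmFactor_mem_span_pow`, `traceSymmFactor_units` (★ O8a-∃ §1 twins with `1 + γ ↦ b + σb·γ`).
* §2 `criterion_eq_normTraceSymm_mul`, `exists_criterion_of_norm_solutions_trace` (★ O8a-∃ §2 twins; conclusion of the latter = ★'s token for token).
* §3 **`ncard_setOf_selfDual_cyclic_eq_relIndex_of_even_uniform`** — the EVEN HALF at every residue characteristic.

## References
* [Jacobowitz1962] R. Jacobowitz, *Hermitian forms over local fields*, Amer. J. Math. 84 (1962), §4, §7 Thm. 7.1 (unimodular lattices, norms at an unramified extension).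
* [Rogawski1990] J. D. Rogawski, *Automorphic Representations of Unitary Groups in Three Variables* (1990), §4.9 Lemma 4.9.3 p. 56 (the count).
* [Serre1979] J.-P. Serre, *Local Fields*, GTM 67 (1979), Ch. V §2 Prop. 3 (norms of units at an unramified extension; Hilbert 90).
-/

set_option autoImplicit false

open Polynomial Finset Matrix
open scoped ValuativeRel Matrix MatrixGroups
open ValuativeRel

namespace Literature.NumberTheory.Automorphic

open Literature.NumberTheory.Automorphic.UnitaryGroup

/-! ## §1 The trace-weighted Cayley symmetriser `u_i = b + σb·γ_i` -/

section Symmetrisation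

variable {K : Type*} [Field K] {n : ℕ} (O : Subring K) (σ : K →+* K) {γ : Fin n → K} {b : K}

/-- **THE TRACE-WEIGHTED CAYLEY QUOTIENT OF TWO NORM-ONE NODES IS SKEW**: with `u_k := b + σb·γ_k`, `σ((γ_i − γ_j)∕(u_i u_j)) = −(γ_i − γ_j)∕(u_i u_j)` when `σ` is an
involution, `σγ = γ⁻¹`, `γ ≠ 0` (`σu_k = u_k·γ_k⁻¹`).  At `b = ½` this is ★ `cayleyQuotient_skew`. [cite: Jacobowitz1962, §4] [cite: Rogawski1990, §4.9 p. 54] -/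
theorem traceCayleyQuotient_skew (hσσ : ∀ x, σ (σ x) = x) (hσγ : ∀ i, σ (γ i) = (γ i)⁻¹) (hγ0 : ∀ i, γ i ≠ 0) (i j : Fin n) :
    σ ((γ i - γ j) / ((b + σ b * γ i) * (b + σ b * γ j))) = -((γ i - γ j) / ((b + σ b * γ i) * (b + σ b * γ j))) := by
  have hi := hγ0 i; have hj := hγ0 j
  have hA : (γ i)⁻¹ - (γ j)⁻¹ = -(γ i - γ j) / (γ i * γ j) := by
    field_simp
    ring
  have hB : (σ b + b * (γ i)⁻¹) * (σ b + b * (γ j)⁻¹) = ((b + σ b * γ i) * (b + σ b * γ j)) / (γ i * γ j) := by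
    field_simp
    ring
  rw [map_div₀, map_sub, map_mul, map_add, map_add, map_mul, map_mul, hσσ, hσγ, hσγ, hA, hB, div_div_div_cancel_right₀ (mul_ne_zero hi hj), neg_div]

/-- **`γ_i − γ_j = s_ij · (u_i u_jδ)`** with `s_ij := (γ_i − γ_j)∕(u_i u_jδ)` (trivial rearrangement, `δ ≠ 0`). [cite: Jacobowitz1962, §4] -/
theorem sub_eq_traceSymm_mul {δ : K} (hδ0 : δ ≠ 0) (hγ1 : ∀ i, b + σ b * γ i ≠ 0) (i j : Fin n) :
    γ i - γ j = (γ i - γ j) / ((b + σ b * γ i) * (b + σ b * γ j) * δ) * ((b + σ b * γ i) * (b + σ b * γ j) * δ) := by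
  rw [div_mul_cancel₀ _ (mul_ne_zero (mul_ne_zero (hγ1 i) (hγ1 j)) hδ0)]

/-- **`s_ij` IS σ-FIXED** for a skew unit `δ` (`σδ = −δ`): skew ∕ skew = fixed. [cite: Serre1979, Ch. V §2] -/
theorem traceSymm_fixed (hσσ : ∀ x, σ (σ x) = x) (hσγ : ∀ i, σ (γ i) = (γ i)⁻¹) (hγ0 : ∀ i, γ i ≠ 0) {δ : K} (hσδ : σ δ = -δ) (i j : Fin n) :
    σ ((γ i - γ j) / ((b + σ b * γ i) * (b + σ b * γ j) * δ)) = (γ i - γ j) / ((b + σ b * γ i) * (b + σ b * γ j) * δ) := by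
  rw [← div_div, map_div₀, traceCayleyQuotient_skew σ hσσ hσγ hγ0, hσδ, neg_div_neg_eq]

/-- **`f′(γ)_i = s_i · λ_i`**: `∏_{j≠i}(γ_i − γ_j) = (∏_{j≠i} s_ij) · ∏_{j≠i} (u_i u_jδ)`. [cite: Jacobowitz1962, §4] [cite: Serre1979, Ch. III §6] -/
theorem nodalDeriv_eq_traceSymm_mul {δ : K} (hδ0 : δ ≠ 0) (hγ1 : ∀ i, b + σ b * γ i ≠ 0) (i : Fin n) :
    ∏ j ∈ univ.erase i, (γ i - γ j) =
      (∏ j ∈ univ.erase i, (γ i - γ j) / ((b + σ b * γ i) * (b + σ b * γ j) * δ)) * ∏ j ∈ univ.erase i, ((b + σ b * γ i) * (b + σ b * γ j) * δ) := by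
  rw [← Finset.prod_mul_distrib]
  exact Finset.prod_congr rfl fun j _ => sub_eq_traceSymm_mul σ hδ0 hγ1 i j

/-- `σ` fixes `s_i = ∏_{j≠i} s_ij`. [cite: Serre1979, Ch. V §2] -/
theorem traceSymmProd_fixed (hσσ : ∀ x, σ (σ x) = x) (hσγ : ∀ i, σ (γ i) = (γ i)⁻¹) (hγ0 : ∀ i, γ i ≠ 0) {δ : K} (hσδ : σ δ = -δ) (i : Fin n) :
    σ (∏ j ∈ univ.erase i, (γ i - γ j) / ((b + σ b * γ i) * (b + σ b * γ j) * δ)) = ∏ j ∈ univ.erase i, (γ i - γ j) / ((b + σ b * γ i) * (b + σ b * γ j) * δ) := by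
  rw [map_prod]
  exact Finset.prod_congr rfl fun j _ => traceSymm_fixed σ hσσ hσγ hγ0 hσδ i j

/-- **`λ_i = (u_iδ)^{n−1} · ∏_{j≠i}u_j`** — the closed form of `∏_{j≠i}(u_i u_jδ)`. [cite: Serre1979, Ch. III §6] -/
theorem traceSymmFactor_eq (δ : K) (i : Fin n) :
    ∏ j ∈ univ.erase i, ((b + σ b * γ i) * (b + σ b * γ j) * δ) = ((b + σ b * γ i) * δ) ^ (n - 1) * ∏ j ∈ univ.erase i, (b + σ b * γ j) := by
  have hcard : (univ.erase i).card = n - 1 := by rw [Finset.card_erase_of_mem (Finset.mem_univ i), Finset.card_univ, Fintype.card_fin]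
  rw [show (fun j => (b + σ b * γ i) * (b + σ b * γ j) * δ) = fun j => ((b + σ b * γ i) * δ) * (b + σ b * γ j) from funext fun j => by ring, Finset.prod_mul_distrib,
    Finset.prod_const, hcard]

/-- `∏_{j≠i}u_j = (∏_j u_j) · u_i⁻¹`. [cite: Serre1979, Ch. III §6] -/
theorem prod_erase_traceCayley_eq (hγ1 : ∀ i, b + σ b * γ i ≠ 0) (i : Fin n) :
    ∏ j ∈ univ.erase i, (b + σ b * γ j) = (∏ j, (b + σ b * γ j)) * (b + σ b * γ i)⁻¹ := by
  rw [← Finset.mul_prod_erase univ (fun j => b + σ b * γ j) (Finset.mem_univ i), mul_comm (b + σ b * γ i), mul_assoc, mul_inv_cancel₀ (hγ1 i), mul_one]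

/-- **`λ ∈ R = O[γ]`**: the symmetrisation factor `λ = ((u)δ)^{n−1} · P₀ · u⁻¹` lies in the order (★ O7: `u = b + σb·γ ∈ R`, powers, the inverse of an element with unit
components, scalars `δ, P₀ ∈ O`). [cite: Serre1979, Ch. III §6] [cite: Jacobowitz1962, §4] -/
theorem traceSymmFactor_mem_span_pow (hγ : ∀ i, γ i ∈ O) (hbO : b ∈ O) (hσbO : σ b ∈ O) (hγ1u : ∀ i, ∃ y ∈ O, y * (b + σ b * γ i) = 1) {δ : K} (hδ : δ ∈ O) :
    (fun i => ∏ j ∈ univ.erase i, ((b + σ b * γ i) * (b + σ b * γ j) * δ)) ∈ Submodule.span O (Set.range fun j : Fin n => fun i => γ i ^ (j : ℕ)) := by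
  have hγ1 : ∀ i, b + σ b * γ i ≠ 0 := fun i h0 => by
    obtain ⟨y, -, hy⟩ := hγ1u i; rw [h0, mul_zero] at hy; exact zero_ne_one hy
  -- `u = b + σb·γ ∈ R`
  have h1γ : (fun i => b + σ b * γ i) ∈ Submodule.span O (Set.range fun j : Fin n => fun i => γ i ^ (j : ℕ)) := by
    have h := eval_mem_span_pow O hγ (C (⟨b, hbO⟩ : O) + C (⟨σ b, hσbO⟩ : O) * X : O[X])
    have he : (fun i => ((C (⟨b, hbO⟩ : O) + C (⟨σ b, hσbO⟩ : O) * X : O[X]).map O.subtype).eval (γ i)) = fun i => b + σ b * γ i := by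
      funext i; simp
    rwa [he] at h
  -- `(u δ)^{n-1} ∈ R`
  have hA : (fun i => ((b + σ b * γ i) * δ) ^ (n - 1)) ∈ Submodule.span O (Set.range fun j : Fin n => fun i => γ i ^ (j : ℕ)) := by
    have hsm : (fun i => (b + σ b * γ i) * δ) = (⟨δ, hδ⟩ : O) • (fun i => b + σ b * γ i) := by
      funext i; simp only [Pi.smul_apply, Subring.smul_def, smul_eq_mul]; ring
    have hmem : (fun i => (b + σ b * γ i) * δ) ∈ Submodule.span O (Set.range fun j : Fin n => fun i => γ i ^ (j : ℕ)) := by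
      rw [hsm]; exact Submodule.smul_mem _ _ h1γ
    have := pow_mem_span_pow O hγ hmem (n - 1)
    exact this
  -- `P₀ · u⁻¹ ∈ R`
  have hB : (fun i => ∏ j ∈ univ.erase i, (b + σ b * γ j)) ∈ Submodule.span O (Set.range fun j : Fin n => fun i => γ i ^ (j : ℕ)) := by
    have hinv := inv_mem_span_pow O hγ h1γ hγ1u
    have hP0 : (∏ j, (b + σ b * γ j)) ∈ O := Subring.prod_mem _ fun j _ => O.add_mem hbO (O.mul_mem hσbO (hγ j))
    have heq : (fun i => ∏ j ∈ univ.erase i, (b + σ b * γ j)) = (⟨∏ j, (b + σ b * γ j), hP0⟩ : O) • (fun i => b + σ b * γ i)⁻¹ := by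
      funext i; rw [prod_erase_traceCayley_eq σ hγ1 i]; simp [Subring.smul_def]
    rw [heq]; exact Submodule.smul_mem _ _ hinv
  have hprod := mul_mem_span_pow O hγ hA hB
  have heq : (fun i => ∏ j ∈ univ.erase i, ((b + σ b * γ i) * (b + σ b * γ j) * δ)) = (fun i => ((b + σ b * γ i) * δ) ^ (n - 1)) * fun i => ∏ j ∈ univ.erase i, (b + σ b * γ j) := by
    funext i; rw [Pi.mul_apply, traceSymmFactor_eq]
  rw [heq]; exact hprod

/-- **`λ` HAS UNIT COMPONENTS** (`u_j = b + σb·γ_j ∈ O^×`, `δ ∈ O^×`). [cite: Jacobowitz1962, §4] -/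
theorem traceSymmFactor_units (hγ : ∀ i, γ i ∈ O) (hbO : b ∈ O) (hσbO : σ b ∈ O) (hγ1u : ∀ i, ∃ y ∈ O, y * (b + σ b * γ i) = 1) {δ : K} (hδ : δ ∈ O) (hδu : ∃ y ∈ O, y * δ = 1) (i : Fin n) :
    ∃ y ∈ O, y * ∏ j ∈ univ.erase i, ((b + σ b * γ i) * (b + σ b * γ j) * δ) = 1 := by
  classical
  -- a finite product of elements of `O` with inverses in `O` has an inverse in `O`
  have key : ∀ (s : Finset (Fin n)) (f : Fin n → K), (∀ j ∈ s, f j ∈ O ∧ ∃ y ∈ O, y * f j = 1) → ∃ y ∈ O, y * ∏ j ∈ s, f j = 1 := by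
    intro s f hf
    induction s using Finset.induction_on with
    | empty => exact ⟨1, O.one_mem, by simp⟩
    | insert a s ha ih =>
      obtain ⟨y, hy, hy1⟩ := ih fun j hj => hf j (Finset.mem_insert_of_mem hj)
      obtain ⟨-, z, hz, hz1⟩ := hf a (Finset.mem_insert_self a s)
      refine ⟨z * y, O.mul_mem hz hy, ?_⟩
      rw [Finset.prod_insert ha]
      linear_combination (∏ j ∈ s, f j) * y * hz1 + hy1
  refine key (univ.erase i) _ fun j _ => ⟨O.mul_mem (O.mul_mem (O.add_mem hbO (O.mul_mem hσbO (hγ i))) (O.add_mem hbO (O.mul_mem hσbO (hγ j)))) hδ, ?_⟩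
  obtain ⟨yi, hyi, hyi1⟩ := hγ1u i
  obtain ⟨yj, hyj, hyj1⟩ := hγ1u j
  obtain ⟨yd, hyd, hyd1⟩ := hδu
  exact ⟨yi * yj * yd, O.mul_mem (O.mul_mem hyi hyj) hyd, by linear_combination (yj * (b + σ b * γ j)) * (yd * δ) * hyi1 + (yd * δ) * hyj1 + hyd1⟩


end Symmetrisation

/-! ## §2 The criterion vector through the trace symmetrisation -/

section Criterion

variable {K : Type*} [Field K] {n : ℕ} (O : Subring K) (σ : K →+* K) {γ : Fin n → K} {b : K}

/-- **`T(a) = (d_i · a_iσ(a_i) · s_i)_i · λ`** (pointwise rearrangement of `f′ = s·λ`). [cite: Jacobowitz1962, §4] -/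
theorem criterion_eq_normTraceSymm_mul {δ : K} (hδ0 : δ ≠ 0) (hγ1 : ∀ i, b + σ b * γ i ≠ 0) (d a : Fin n → K) :
    (fun i => d i * a i * σ (a i) * ∏ j ∈ univ.erase i, (γ i - γ j)) =
      (fun i => d i * (a i * σ (a i)) * ∏ j ∈ univ.erase i, (γ i - γ j) / ((b + σ b * γ i) * (b + σ b * γ j) * δ)) *
        fun i => ∏ j ∈ univ.erase i, ((b + σ b * γ i) * (b + σ b * γ j) * δ) := by
  funext i
  rw [Pi.mul_apply, nodalDeriv_eq_traceSymm_mul σ hδ0 hγ1 i]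
  ring

/-- **O8a-∃ (abstract norm hypothesis): THE GOOD SET IS NON-EMPTY** when the `n` norm equations `a_i σ(a_i) · (d_i s_i) = 1` are solvable: then `T(a) = λ ∈ R` with unit components
(`γ` norm-one nodes in `O` with `u_i = b + σb·γ_i ∈ O^×`, `δ ∈ O^×` skew).  At an unramified place the equations are solvable iff `v(d_i) + v(f′(γ)_i)` is even (§3).
[cite: Jacobowitz1962, §4] [cite: Serre1979, Ch. V §2 Prop. 3] -/
theorem exists_criterion_of_norm_solutions_trace (hγ : ∀ i, γ i ∈ O) (hbO : b ∈ O) (hσbO : σ b ∈ O) (hγ1u : ∀ i, ∃ y ∈ O, y * (b + σ b * γ i) = 1)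
    {δ : K} (hδ : δ ∈ O) (hδu : ∃ y ∈ O, y * δ = 1) (d a : Fin n → K)
    (ha : ∀ i, a i * σ (a i) * (d i * ∏ j ∈ univ.erase i, (γ i - γ j) / ((b + σ b * γ i) * (b + σ b * γ j) * δ)) = 1) :
    (fun i => d i * a i * σ (a i) * ∏ j ∈ univ.erase i, (γ i - γ j)) ∈ Submodule.span O (Set.range fun j : Fin n => fun i => γ i ^ (j : ℕ)) ∧
      ∀ i, ∃ y ∈ O, y * (d i * a i * σ (a i) * ∏ j ∈ univ.erase i, (γ i - γ j)) = 1 := by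
  have hγ1 : ∀ i, b + σ b * γ i ≠ 0 := fun i h0 => by
    obtain ⟨y, -, hy⟩ := hγ1u i; rw [h0, mul_zero] at hy; exact zero_ne_one hy
  have hδ0 : δ ≠ 0 := fun h0 => by obtain ⟨y, -, hy⟩ := hδu; rw [h0, mul_zero] at hy; exact zero_ne_one hy
  have hfirst : (fun i => d i * (a i * σ (a i)) * ∏ j ∈ univ.erase i, (γ i - γ j) / ((b + σ b * γ i) * (b + σ b * γ j) * δ)) = 1 := by
    funext i
    rw [Pi.one_apply]
    linear_combination ha i
  have hT : (fun i => d i * a i * σ (a i) * ∏ j ∈ univ.erase i, (γ i - γ j)) = fun i => ∏ j ∈ univ.erase i, ((b + σ b * γ i) * (b + σ b * γ j) * δ) := by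
    rw [criterion_eq_normTraceSymm_mul σ hδ0 hγ1 d a, hfirst, one_mul]
  refine ⟨?_, fun i => ?_⟩
  · rw [hT]; exact traceSymmFactor_mem_span_pow O σ hγ hbO hσbO hγ1u hδ
  · have h : d i * a i * σ (a i) * ∏ j ∈ univ.erase i, (γ i - γ j) = ∏ j ∈ univ.erase i, ((b + σ b * γ i) * (b + σ b * γ j) * δ) := congrFun hT i
    rw [h]
    exact traceSymmFactor_units O σ hγ hbO hσbO hγ1u hδ hδu i

end Criterion

/-! ## §3 The even half, uniform in the residue characteristic -/

section Parity

variable {E : Type*} [Field E] [ValuativeRel E] {n : ℕ} (σ : E →+* E)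

/-- **Deep nodes: `u_i = b + σb·γ_i` is a unit of `𝒪`** at EVERY residue characteristic (`u_i = 1 + σb(γ_i − 1)`, `|γ_i − 1| < 1`, `b, σb ∈ 𝒪`, `b + σb = 1`) — replaces
★ `exists_mul_one_add_eq_one_of_deep (h2 : IsUnit 2)`. [cite: Serre1979, Ch. II §1] -/
theorem exists_mul_traceCayley_eq_one_of_deep (hσO : ∀ x : 𝒪[E], σ x ∈ 𝒪[E]) {b : 𝒪[E]} (hb : (b : E) + σ b = 1) {γ : Fin n → E} (hγ : ∀ i, γ i ∈ 𝒪[E])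
    (hγ1 : ∀ i, valuation E (γ i - 1) < 1) (i : Fin n) : ∃ y ∈ 𝒪[E], y * ((b : E) + σ b * γ i) = 1 := by
  have hσbO : σ (b : E) ∈ 𝒪[E] := hσO b
  have hmem : (b : E) + σ b * γ i ∈ 𝒪[E] := add_mem b.2 (mul_mem hσbO (hγ i))
  rw [← valuation_eq_one_iff_exists_mul_eq_one hmem]
  have hsum : (b : E) + σ b * γ i = 1 + σ b * (γ i - 1) := by linear_combination hb
  have hlt : valuation E (σ (b : E) * (γ i - 1)) < 1 := by
    rw [map_mul]
    exact mul_lt_one_of_nonneg_of_lt_one_right ((Valuation.mem_integer_iff _ _).1 hσbO) zero_le (hγ1 i)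
  rw [hsum, Valuation.map_add_eq_of_lt_left _ (by rw [map_one]; exact hlt), map_one]

variable [UniformSpace E] [IsUniformAddGroup E] [IsNonarchimedeanLocalField E]

/-- **THE EVEN HALF, UNIFORM IN THE RESIDUE CHARACTERISTIC: `#S(τ) = [C : R^×]`.**  ★ `ncard_setOf_selfDual_cyclic_eq_relIndex_of_even` with `(h2) (δ) (hδ) (hσδ)` DELETED
and the trace token `(htr : ∃ b : 𝒪, b + σ b = 1)` ADDED (same token and position as ★ :243's): if every criterion scalar has the valuation of an EVEN power of `ϖ`, a GOOD
`a₀` exists (trace-weighted Cayley symmetriser `u_i = b + σb·γ_i` of §1, skew unit `δ := σa − a` from `hmove`, norm equations by ★ `exists_norm_solution_of_zpow_even`), and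
★ O8a-4 ∘ ★ O8a-1 count the set — conclusion = ★ :169's TOKEN FOR TOKEN. [cite: Jacobowitz1962, §7 Thm. 7.1] [cite: Serre1979, Ch. V §2 Prop. 3] [cite: Rogawski1990, §4.9 Lemma 4.9.3 p. 56] -/
theorem ncard_setOf_selfDual_cyclic_eq_relIndex_of_even_uniform (hσσ : ∀ x, σ (σ x) = x) (hσO : ∀ x : 𝒪[E], σ x ∈ 𝒪[E])
    (hmove : ∃ a : 𝒪[E], IsUnit ((⟨σ a, hσO a⟩ : 𝒪[E]) - a)) (hσv : ∀ x, valuation E (σ x) = valuation E x)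
    (htr : ∃ b : 𝒪[E], (b : E) + σ b = 1) {ϖ : E} (hϖ0 : ϖ ≠ 0) (hσϖ : σ ϖ = ϖ)
    (J : GL (Fin n) E) (hJ : J ∈ glInt n E) (hJh : ((J : Matrix (Fin n) (Fin n) E).map σ)ᵀ = J)
    (P : GL (Fin n) E) (d : Fin n → E) (hP : formCongr σ P (J : Matrix (Fin n) (Fin n) E) = diagonal d) (hσd : ∀ i, σ (d i) = d i)
    {γ : Fin n → E} (hγ : ∀ i, γ i ∈ 𝒪[E]) (hinj : Function.Injective γ) (hσγ : ∀ i, σ (γ i) = (γ i)⁻¹)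
    (hγ1 : ∀ i, valuation E (γ i - 1) < 1)
    (hev : ∀ i, ∃ k : ℤ, valuation E (d i * ∏ j ∈ univ.erase i, (γ i - γ j)) = valuation E (ϖ ^ (2 * k))) :
    {Λ : Submodule 𝒪[E] (Fin n → E) |
        (∃ u ∈ unitaryGroupOfForm σ (J : Matrix (Fin n) (Fin n) E), Λ = Submodule.span 𝒪[E] (Set.range ((u : Matrix (Fin n) (Fin n) E))ᵀ)) ∧
        ∃ w : Fin n → E, Λ = Submodule.span 𝒪[E] (Set.range fun j : Fin n =>
          ((P : Matrix (Fin n) (Fin n) E) * diagonal γ * ((P⁻¹ : GL (Fin n) E) : Matrix (Fin n) (Fin n) E)) ^ (j : ℕ) *ᵥ w)}.ncard =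
      ((Algebra.adjoin 𝒪[E] ({γ} : Set (Fin n → E))).toSubmonoid.units).relIndex
        (((Algebra.adjoin 𝒪[E] ({γ} : Set (Fin n → E))).toSubmonoid.units).comap
          (MonoidHom.id (Fin n → E)ˣ * (Units.map (RingHom.pi fun i : Fin n => σ.comp (Pi.evalRingHom (fun _ : Fin n => E) i)).toMonoidHom))) := by
  classical
  -- the dictionary inputs of ★ O8a-4
  have hγ0 : ∀ i, γ i ≠ 0 := fun i h0 => by
    have := hγ1 i; rw [h0, zero_sub, Valuation.map_neg, map_one] at this; exact lt_irrefl _ this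
  have hγu : ∀ i, ∃ y ∈ 𝒪[E], y * γ i = 1 := fun i => ⟨σ (γ i), hσO ⟨γ i, hγ i⟩, by rw [hσγ i, inv_mul_cancel₀ (hγ0 i)]⟩
  obtain ⟨r, hr⟩ := exists_poly_eval_mul_eq_one 𝒪[E] hγ hγu
  have hnorm : ∀ u : 𝒪[E], IsUnit u → σ u = u → ∃ t : 𝒪[E], (t : E) * σ t = u := fun u hu hσu =>
    LocalFields.UnramifiedQuadraticNorm.exists_mul_map_eq_of_isUnit_integer σ hσσ hσO hmove u hu hσu
  rw [ncard_setOf_selfDual_cyclic_eq_natCard_good σ hσσ hσO htr hnorm hσv J hJ hJh P d hP hγ hinj hσγ hr]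
  -- the trace witness `b` and the skew unit `δ := σa − a` from `hmove`
  obtain ⟨b, hb⟩ := htr
  have hbO : (b : E) ∈ 𝒪[E] := b.2
  have hσbO : σ (b : E) ∈ 𝒪[E] := hσO b
  obtain ⟨a₀, ha₀⟩ := id hmove
  set δ : 𝒪[E] := (⟨σ a₀, hσO a₀⟩ : 𝒪[E]) - a₀ with hδdef
  have hδE : (δ : E) = σ a₀ - a₀ := rfl
  have hσδ : σ (δ : E) = -(δ : E) := by rw [hδE, map_sub, hσσ]; ring
  have hu := exists_mul_traceCayley_eq_one_of_deep σ hσO hb hγ hγ1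
  obtain ⟨hδ0, hδinv⟩ := Literature.RingTheory.GaloisAlgebras.coe_ne_zero_and_inv_mem_of_isUnit 𝒪[E] ha₀
  have hδu : ∃ y ∈ 𝒪[E], y * (δ : E) = 1 := ⟨(δ : E)⁻¹, hδinv, inv_mul_cancel₀ hδ0⟩
  -- the symmetrised scalars `c_i = d_i · ∏ (γ_i − γ_j)/(u_i u_j δ)` are `σ`-fixed with the valuation of `d_i f′(γ_i)`
  have hsol : ∀ i, ∃ a : E, a * σ a * (d i * ∏ j ∈ univ.erase i, (γ i - γ j) / (((b : E) + σ b * γ i) * ((b : E) + σ b * γ j) * δ)) = 1 := by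
    intro i
    obtain ⟨k, hk⟩ := hev i
    have hσc : σ (d i * ∏ j ∈ univ.erase i, (γ i - γ j) / (((b : E) + σ b * γ i) * ((b : E) + σ b * γ j) * δ)) =
        d i * ∏ j ∈ univ.erase i, (γ i - γ j) / (((b : E) + σ b * γ i) * ((b : E) + σ b * γ j) * δ) := by
      rw [map_mul, hσd i, traceSymmProd_fixed σ hσσ hσγ hγ0 hσδ i]
    -- valuation: the unit factor `∏ (u_i u_j δ)`
    obtain ⟨y, hyO, hy⟩ := traceSymmFactor_units 𝒪[E] σ hγ hbO hσbO hu δ.2 hδu i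
    have hu0 : ∀ j, (b : E) + σ b * γ j ≠ 0 := fun j h0 => by
      obtain ⟨z, _, hz⟩ := hu j; rw [h0, mul_zero] at hz; exact zero_ne_one hz
    have hF : valuation E (∏ j ∈ univ.erase i, (((b : E) + σ b * γ i) * ((b : E) + σ b * γ j) * (δ : E))) = 1 := by
      refine valuation_eq_one_of_exists_mul_eq_one ?_ ⟨y, hyO, hy⟩
      exact prod_mem fun j _ => mul_mem (mul_mem (add_mem hbO (mul_mem hσbO (hγ i))) (add_mem hbO (mul_mem hσbO (hγ j)))) δ.2
    have hval : valuation E (d i * ∏ j ∈ univ.erase i, (γ i - γ j) / (((b : E) + σ b * γ i) * ((b : E) + σ b * γ j) * δ)) = valuation E (ϖ ^ (2 * k)) := by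
      have heq : d i * ∏ j ∈ univ.erase i, (γ i - γ j) =
          (d i * ∏ j ∈ univ.erase i, (γ i - γ j) / (((b : E) + σ b * γ i) * ((b : E) + σ b * γ j) * δ)) *
            ∏ j ∈ univ.erase i, (((b : E) + σ b * γ i) * ((b : E) + σ b * γ j) * (δ : E)) := by
        rw [mul_assoc, ← nodalDeriv_eq_traceSymm_mul σ hδ0 hu0 i]
      have h := hk
      rw [heq, map_mul, hF, mul_one] at h
      exact h
    exact exists_norm_solution_of_zpow_even σ hσσ hσO hmove hϖ0 hσϖ hσc k hval
  choose a ha using hsol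
  obtain ⟨hmem, hunit⟩ := exists_criterion_of_norm_solutions_trace 𝒪[E] σ hγ hbO hσbO hu δ.2 hδu d a ha
  exact natCard_setOf_cyclicLattice_good_eq_relIndex 𝒪[E] hγ σ d a hmem hunit

end Parity

end Literature.NumberTheory.Automorphic
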